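import Literature.Computability.Complexity.UmansSetup
import Literature.Computability.Complexity.UmansGoodCurves
import Literature.Computability.Complexity.UmansThm14
import Literature.Computability.Complexity.UmansFPWalkFP
import Literature.Computability.Complexity.CircuitClassesProofs
import Literature.Computability.MetaComplexity.NaturalProofs
import Literature.Computability.MetaComplexity.MCSPGeneratorCircuits
import HarnessLib

/-!
# Umans' generator: from a distinguisher to the reconstruction advice and machine

Literature / circuit complexity — derandomization. The reconstruction side of the proof of
C. Umans, *Pseudo-random generators for all hardnesses*, JCSS 67 (2003), Thm. 14 / Thm. 6, for the
field data the generator actually uses (`UmansSetup.lean`), in three parts.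

**Part 1 (dense predictor).** A circuit `C` of size `m` with distinguishing advantage `> 1/m`
against the binary generator yields (Yao's next-bit lemma, `YaoNextBit.lean`; the
Reed–Solomon–Hadamard conversion, `QaryConversion.lean`, Lemma 13) a next-ELEMENT list predictor for
the `q^d`-ary generator `Ẽ(αy), …, Ẽ(αᵐy)` that succeeds on a `≈ 1/m²` fraction of the seeds `y`:
the set `goodSeeds` of the reconstruction context (`UmansGoodCurves.lean`) is dense.

* `seedθ` (the parsing bijection `{0,1}^{(d+2)(M+1)} ≃ L × (K × [q])`), `card_filter_restrict`
  (ignored seed bits do not change acceptance counts);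
* `fixInput` (hard-wiring input `0` of a circuit: the `j = 0` case of Yao's lemma is moved to `j = 1`
  by the shift symmetry `y ↦ α y` of the generator);
* **`exists_dense_predictor`**: the circuit `C'`, position `j ≥ 1`, sign and coins with
  `|L| ≤ m² (#goodSeeds + 2)` for the context `Ctx(j, Ẽ, α, σ, predG …)`.

**Part 2 (the context and Thm. 14).** The reconstruction theorem (Thm. 14; `UmansThm14.lean`) is
stated for an abstract context `Ctx(n₀, Ẽ, α, σ, g)`; here it is instantiated with `Ẽ = EF xs`,
`α = αL` (primitive), `σ = frob^{d-1}` (the inverse Frobenius), `g = predG …`, and its algebraic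
hypotheses are discharged: the curve-degree bound of the coordinates of `Ẽ` (P1*), `σᵈ = 1`,
`σ α = α^{q^{d-1}}`, `Ẽ ∘ σ = σ ∘ Ẽ`, `q q' ≡ 1 ≡ q^d (mod q^d - 1)`, primitivity.

* `XC` (the context), `XC_hE`, `XC_hσ`, `XC_hσα`, `XC_hEσ`, `qq'_mod`, `qd_mod`;
* `recon_advice` — Thm. 14 for `XC`: good curves `b, v`, an offset `c⋆`, and
  `reconstruct(digits of z) = Ẽ(α^{z + c⋆ + 1})` for all `z < q^d`, under the numeric hypotheses.

**Part 3 (the machine).** The reconstruction ("there is a circuit of size `poly(m)` which, given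
the advice, computes `x_i` from `i`") is realised as ONE fixed polynomial-time string function
`Hf(⟨adv, i⟩)` of the advice and the index bits (`hOut`, a `CodeFP` composition of `reconstructT`
of `UmansFPWalkFP.lean` with the digit computation and the readout), and through the tree's
`FP ⊆ P/poly` bridge (`exists_poly_cktSize_apply_getD`) the padded table `x` of `Y` has circuit
complexity at most `Q(|adv| + ℓ)` for a fixed polynomial `Q`, whenever the advice is correct.

* `AdvT`, `advE` (the advice tuple and its code), `hOut` (the machine), `hOutC` (`CodeFP`),
  `Hf`, `Hf_mem_FP`, `Hf_apply`;
* `bitsToNat_ofFn` (`bitsToNat` is the tree's cube enumeration `boolFunEquivFin`);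
* `stringCC_le_of_advice` — **if `hOut adv` reads the padded table, `CC(Y) ≤ Q(|advE adv| + ℓ)`**.

Everything is proved; no named fact.

## References

* C. Umans, *Pseudo-random generators for all hardnesses*, JCSS 67 (2003), Thm. 8 (P1*), Def. 9,
  Lemma 13, Thm. 14, §6, Thm. 6 [Umans2003].
* A. C.-C. Yao, *Theory and applications of trapdoor functions*, FOCS 1982 (next-bit lemma) [Yao1982].
* S. Arora, B. Barak, *Computational Complexity*, CUP 2009, Thm. 6.6 (`P ⊆ P/poly`) [AroraBarak2009].
-/

noncomputable section

namespace Literature.Computability.Complexity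

open Polynomial Finset Literature.InformationTheory.Coding
open Literature.InformationTheory.Coding.GF2X

namespace UmansFP

/-! ## Part 1: from a distinguisher to a dense set of good seeds -/

/-! ### Bit strings and parsing -/

/-- `bitsToNat` is injective on lists of a common length (via `Com.testBit_bitsToNat` of
`StackWordArith.lean`). [folklore] -/
theorem bitsToNat_injOn {l l' : List Bool} (hlen : l.length = l'.length) (h : bitsToNat l = bitsToNat l') : l = l' := by
  apply List.ext_getElem hlen fun i h1 h2 => ?_
  have := congrArg (fun n => n.testBit i) h
  simp only [Com.testBit_bitsToNat] at this
  rwa [List.getD_eq_getElem _ _ h1, List.getD_eq_getElem _ _ h2] at this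

/-- A bit of a string is a bit of its block. [folklore] -/
theorem getD_eq_block (w : List Bool) {b : ℕ} (hb : 0 < b) (t : ℕ) :
    w.getD t false = ((w.drop (t / b * b)).take b).getD (t % b) false := by
  rw [List.getD_eq_getElem?_getD, List.getD_eq_getElem?_getD, List.getElem?_take, if_pos (Nat.mod_lt t hb), List.getElem?_drop,
    Nat.div_add_mod']

/-- **A string of `k` blocks of `b` bits is determined by its parsed blocks.** [folklore] -/
theorem parseL_injOn {b k : ℕ} (hb : 0 < b) {w w' : List Bool} (hw : w.length = k * b) (hw' : w'.length = k * b)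
    (h : parseL b k w = parseL b k w') : w = w' := by
  have hblk : ∀ i, i < k → (w.drop (i * b)).take b = (w'.drop (i * b)).take b := by
    intro i hi
    have := congrArg (fun l : List ℕ => l.getD i 0) h
    simp only [parseL_getD _ _ _ hi] at this
    exact bitsToNat_injOn (by rw [List.length_take, List.length_take, List.length_drop, List.length_drop, hw, hw']) this
  apply List.ext_getElem (by rw [hw, hw']) fun t h1 h2 => ?_
  have ht : t < k * b := by rw [← hw]; exact h1
  have hq : t / b < k := (Nat.div_lt_iff_lt_mul hb).2 ht
  rw [← List.getD_eq_getElem _ false h1, ← List.getD_eq_getElem _ false h2, getD_eq_block w hb t, getD_eq_block w' hb t, hblk _ hq]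

/-- Parsed entries are below `2ᵇ` (also out of range, where they are `0`). [folklore] -/
theorem parseL_getD_lt (b k : ℕ) (w : List Bool) (i : ℕ) : (parseL b k w).getD i 0 < 2 ^ b := by
  obtain ⟨hlen, hlt⟩ := parseL_spec b k w
  by_cases hi : i < k
  · rw [List.getD_eq_getElem _ _ (by rw [hlen]; exact hi)]; exact hlt _ (List.getElem_mem _)
  · rw [List.getD_eq_default _ _ (by rw [hlen]; omega)]; exact Nat.two_pow_pos _

/-! ### The parsing bijection -/

namespace PrmOK

section Seeds

variable {cap a M d c0 : ℕ} [hirr : Fact (Irreducible (pOf M (pcOf cap a M d)))]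

/-- **The parse of a seed of `(d+2)(M+1)` bits**: `d` blocks give `y ∈ L`, one block `a ∈ K`, one
block `v ∈ [q]`. [cite: Umans2003, Lemma 13 ("`G'` takes a seed `(y, j)`"), Thm. 6] -/
def _root_.Literature.Computability.Complexity.UmansFP.seedParse (cap a M d : ℕ) [Fact (Irreducible (pOf M (pcOf cap a M d)))] (v : Fin ((d + 2) * (M + 1)) → Bool) :
    LF cap a M d × (GF2 M × Fin (2 ^ (M + 1))) :=
  let prs := parseL (M + 1) (d + 2) (List.ofFn v)
  (lElt M (pcOf cap a M d) (prs.take d), (GF2.elt M (prs.getD d 0), ⟨prs.getD (d + 1) 0, parseL_getD_lt _ _ _ _⟩))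

variable (V : PrmOK cap a M d c0)
include V

/-- **The parse is injective.** [folklore] -/
theorem seedParse_injective : Function.Injective (seedParse cap a M d) := by
  intro v v' h
  have hpc := V.pc_spec.1
  simp only [seedParse, Prod.mk.injEq, Fin.mk.injEq] at h
  obtain ⟨h1, h2, h3⟩ := h
  set prs := parseL (M + 1) (d + 2) (List.ofFn v) with hprs
  set prs' := parseL (M + 1) (d + 2) (List.ofFn v') with hprs'
  obtain ⟨hlen, hlt⟩ := parseL_spec (M + 1) (d + 2) (List.ofFn v)
  obtain ⟨hlen', hlt'⟩ := parseL_spec (M + 1) (d + 2) (List.ofFn v')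
  have hrep : LRep M d (prs.take d) := ⟨by rw [List.length_take, hlen]; omega, fun x hx => hlt x (List.mem_of_mem_take hx)⟩
  have hrep' : LRep M d (prs'.take d) := ⟨by rw [List.length_take, hlen']; omega, fun x hx => hlt' x (List.mem_of_mem_take hx)⟩
  have htake : prs.take d = prs'.take d := lElt_injOn hpc hrep hrep' h1
  have hd0 : prs.getD d 0 = prs'.getD d 0 := GF2.elt_injective (parseL_getD_lt _ _ _ _) (parseL_getD_lt _ _ _ _) h2
  have hall : prs = prs' := by
    apply List.ext_getElem (by rw [hlen, hlen']) fun i hi hi' => ?_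
    rw [hlen] at hi
    rcases Nat.lt_or_ge i d with hlt | hge
    · have := congrArg (fun l : List ℕ => l.getD i 0) htake
      simp only [List.getD_eq_getElem?_getD, List.getElem?_take, if_pos hlt] at this
      rw [← List.getD_eq_getElem?_getD, ← List.getD_eq_getElem?_getD, List.getD_eq_getElem _ _ (by rw [hlen]; exact hi),
        List.getD_eq_getElem _ _ hi'] at this
      exact this
    · have hi2 : i = d ∨ i = d + 1 := by omega
      rcases hi2 with rfl | rfl
      · rwa [List.getD_eq_getElem _ _ (by rw [hlen]; omega), List.getD_eq_getElem _ _ hi'] at hd0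
      · rwa [List.getD_eq_getElem _ _ (by rw [hlen]; omega), List.getD_eq_getElem _ _ hi'] at h3
  have hw := parseL_injOn (b := M + 1) (k := d + 2) (Nat.succ_pos M) (List.length_ofFn (f := v)) (List.length_ofFn (f := v')) hall
  exact List.ofFn_injective hw

/-- The seed space and `L × (K × [q])` have the same size `2^{(d+2)(M+1)}`. [folklore] -/
theorem card_seed_eq : Fintype.card (Fin ((d + 2) * (M + 1)) → Bool) = Fintype.card (LF cap a M d × (GF2 M × Fin (2 ^ (M + 1)))) := by
  rw [Fintype.card_fun, Fintype.card_bool, Fintype.card_fin, Fintype.card_prod, Fintype.card_prod, card_LF V.hlen, card_GF2, Fintype.card_fin,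
    ← pow_mul, ← pow_add, ← pow_add]
  congr 1; ring

/-- **The parsing bijection** `{0,1}^{(d+2)(M+1)} ≃ L × (K × [q])`. [cite: Umans2003, Lemma 13, Thm. 6] -/
def seedθ : (Fin ((d + 2) * (M + 1)) → Bool) ≃ LF cap a M d × (GF2 M × Fin (2 ^ (M + 1))) :=
  Equiv.ofBijective (seedParse cap a M d) ((Fintype.bijective_iff_injective_and_card _).2 ⟨V.seedParse_injective, V.card_seed_eq⟩)

/-- The bijection is the parse. [folklore] -/
theorem seedθ_apply (v : Fin ((d + 2) * (M + 1)) → Bool) : V.seedθ v = seedParse cap a M d v := rfl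

end Seeds

end PrmOK

/-! ### Ignored seed bits -/

/-- Restriction of a seed to its first `n` bits. [folklore] -/
def restrictSeed {ℓ n : ℕ} (h : n ≤ ℓ) (s : Fin ℓ → Bool) : Fin n → Bool := fun i => s (Fin.castLE h i)

/-- **Counting seeds through a restriction**: the ignored `ℓ - n` bits contribute a factor `2^{ℓ-n}`. [folklore] -/
theorem card_filter_restrict {ℓ n : ℕ} (h : n ≤ ℓ) (P : (Fin n → Bool) → Prop) [DecidablePred P] :
    (univ.filter fun s : Fin ℓ → Bool => P (restrictSeed h s)).card = 2 ^ (ℓ - n) * (univ.filter P).card := by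
  classical
  -- split `Fin ℓ ≃ Fin n ⊕ Fin (ℓ - n)`
  let e : (Fin ℓ → Bool) ≃ (Fin n → Bool) × (Fin (ℓ - n) → Bool) :=
    (Equiv.arrowCongr (finSumFinEquiv.trans (finCongr (by omega))).symm (Equiv.refl Bool)).trans (Equiv.sumArrowEquivProdArrow _ _ _)
  have he : ∀ s : Fin ℓ → Bool, (e s).1 = restrictSeed h s := by
    intro s; funext i; rfl
  have hmap : (univ.filter fun s : Fin ℓ → Bool => P (restrictSeed h s)) = ((univ.filter fun p : (Fin n → Bool) × (Fin (ℓ - n) → Bool) => P p.1).map e.symm.toEmbedding) := by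
    ext s
    simp only [mem_filter, mem_univ, true_and, mem_map_equiv, Equiv.symm_symm]
    rw [← he]
  rw [hmap, card_map]
  have hprod : (univ.filter fun p : (Fin n → Bool) × (Fin (ℓ - n) → Bool) => P p.1) = (univ.filter P) ×ˢ (univ : Finset (Fin (ℓ - n) → Bool)) := by
    ext p; simp
  rw [hprod, card_product, card_univ, Fintype.card_fun, Fintype.card_bool, Fintype.card_fin, mul_comm]

/-! ### Hard-wiring an input of a circuit -/

/-- **Fixing input `0` of a circuit to a constant** costs one more gate over `B₂`. [cite: Vollmer1999, §1.1] -/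
theorem exists_fixInput {m : ℕ} (C : Circuit (Fin (m + 2))) (hC : C.IsOver B2) (b : Bool) :
    ∃ C' : Circuit (Fin (m + 2)), C'.IsOver B2 ∧ C'.size ≤ C.size + 1 ∧
      ∀ x, C'.eval x = C.eval fun i => if i = 0 then b else x i := by
  have hin : CktSize B2 (fun (x : Fin (m + 2) → Bool) (i : Fin (m + 2)) => if i = 0 then b else x i) (∑ i : Fin (m + 2), if i = 0 then 1 else 0) := by
    refine CktSize.pi_fin fun i => ?_
    by_cases hi : i = 0
    · simp only [hi, if_true]; exact cktSize_const _ b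
    · simp only [hi, if_false]; exact (CktSize.proj B2 fun _ : Unit => i).congr fun _ _ => rfl
  have hsum : (∑ i : Fin (m + 2), if i = 0 then 1 else 0) = 1 := by
    rw [Finset.sum_ite_eq' univ (0 : Fin (m + 2)) (fun _ => 1)]; simp
  rw [hsum] at hin
  have h := hin.comp (C.cktSize_eval hC)
  obtain ⟨C', h1, h2, h3⟩ := CktSize.toCircuit h
  exact ⟨C', h1, by omega, fun x => h3 x⟩

/-- Gates of a circuit over `B₂` have fan-in `≤ 2`. [folklore] -/
theorem arity_le_of_isOver_B2 {ι : Type*} {C : Circuit ι} (h : C.IsOver B2) : ∀ g ∈ C.gates, g.arity ≤ 2 := fun g hg => h g hg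

/-! ### Yao's predictor, moved off position `0` -/

section Yao

variable {S : Type*} [Fintype S] {m : ℕ}

/-- The predictor only reads the bits before its position. [cite: Yao1982, next-bit lemma] -/
theorem pred_prefix (T : (Fin m → Bool) → Bool) (j : Fin m) (sgn : Bool) (w z : Fin m → Bool) :
    YaoNB.pred T j sgn w z = YaoNB.pred T j sgn w fun k => if (k : ℕ) < (j : ℕ) then z k else false := by
  rw [YaoNB.pred, YaoNB.pred]
  congr 3
  exact congrArg T (funext fun i => by split_ifs <;> rfl)

/-- **Moving Yao's predictor off position `0`** (for a generator with the shift symmetry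
`G s 1 = G (sh s) 0`, `sh` a bijection): a predictor for position `0` (a constant) becomes a
predictor for position `1` with the same number of successes, by hard-wiring its input `0`.
[cite: Umans2003, §6 ("by the symmetry of `G_x` we may assume …")] -/
theorem bump_predictor (G : S → Fin (m + 2) → Bool) (T : (Fin (m + 2) → Bool) → Bool) (sgn : Bool) (w : Fin (m + 2) → Bool)
    (sh : S ≃ S) (hsh : ∀ s, G s 1 = G (sh s) 0) :
    let T' : (Fin (m + 2) → Bool) → Bool := fun v => T fun i => if i = 0 then w 0 else v i
    (univ.filter fun s : S => YaoNB.pred T' 1 (sgn ^^ (w 0 ^^ w 1)) w (G s) = G s 1).card =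
      (univ.filter fun s : S => YaoNB.pred T 0 sgn w (G s) = G s 0).card := by
  intro T'
  -- both predictors are the same constant
  set c₀ := ((w 0) ^^ !(T w)) ^^ sgn with hc₀
  have h0 : ∀ z, YaoNB.pred T 0 sgn w z = c₀ := fun z => by
    rw [YaoNB.pred, hc₀]
    have hw : (fun i : Fin (m + 2) => if (i : ℕ) < ((0 : Fin (m + 2)) : ℕ) then z i else w i) = w :=
      funext fun i => by rw [if_neg (by simp only [Fin.val_zero]; exact Nat.not_lt_zero _)]
    rw [hw]
  have h1 : ∀ z, YaoNB.pred T' 1 (sgn ^^ (w 0 ^^ w 1)) w z = c₀ := fun z => by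
    rw [YaoNB.pred, hc₀]
    have hT : T' (fun i : Fin (m + 2) => if (i : ℕ) < ((1 : Fin (m + 2)) : ℕ) then z i else w i) = T w := by
      show T _ = T w
      refine congrArg T (funext fun i => ?_)
      by_cases hi : i = 0
      · rw [if_pos hi, hi]
      · rw [if_neg hi]
        show (if (i : ℕ) < ((1 : Fin (m + 2)) : ℕ) then z i else w i) = w i
        rw [if_neg]
        rw [Fin.val_one]
        intro hlt
        exact hi (Fin.ext (by simp only [Fin.val_zero]; omega))
    rw [hT]
    cases w 0 <;> cases w 1 <;> cases T w <;> cases sgn <;> rfl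
  simp_rw [h0, h1]
  -- count through the shift
  rw [← Finset.card_map sh.toEmbedding]
  congr 1
  ext s
  simp only [mem_map_equiv, mem_filter, mem_univ, true_and]
  rw [hsh, Equiv.apply_symm_apply]

end Yao

/-! ### The list predictor only reads the prefix -/

section ListPred

variable {K : Type*} [Field K] [Fintype K] [DecidableEq K] {d b : ℕ} (lab : K ≃ Fin (2 ^ b))

omit [Fintype K] [DecidableEq K] in
/-- `recv` only reads the symbols before position `i`. [cite: Umans2003, Lemma 13 (proof)] -/
theorem recv_congr {m : ℕ} (P : (Fin m → Bool) → Bool) (i : Fin m) {zs zs' : Fin m → (Fin d → K)}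
    (h : ∀ k : Fin m, (k : ℕ) < (i : ℕ) → zs k = zs' k) : QConv.recv lab P i zs = QConv.recv lab P i zs' := by
  funext pos
  rw [QConv.recv, QConv.recv]
  congr 1
  funext k
  split_ifs with hk
  · rw [h k hk]
  · rfl

/-- `listPred` only reads the symbols before position `i`. [cite: Umans2003, Lemma 13 (proof)] -/
theorem listPred_congr {m : ℕ} (P : (Fin m → Bool) → Bool) (i : Fin m) (D A : ℕ) {zs zs' : Fin m → (Fin d → K)}
    (h : ∀ k : Fin m, (k : ℕ) < (i : ℕ) → zs k = zs' k) : QConv.listPred lab P i D A zs = QConv.listPred lab P i D A zs' := by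
  rw [QConv.listPred, QConv.listPred, recv_congr lab P i h]

end ListPred

/-! ### From a distinguisher to a dense set of good seeds -/

namespace PrmOK

section Main

variable {cap a M d c0 : ℕ} [hirr : Fact (Irreducible (pOf M (pcOf cap a M d)))]
variable (V : PrmOK cap a M d c0)
include V

/-- Coordinates and `vecToL` are inverse. [folklore] -/
theorem vecToL_coord (x : LF cap a M d) : vecToL (NB V.hlen) (fun j => (NB V.hlen).coord j x) = x := by
  simp only [vecToL, Module.Basis.coord_apply]
  exact (NB V.hlen).sum_repr x

/-- **The shift symmetry of the binary generator**: bit `1` on the seed `(y, pos)` is bit `0` on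
`(α y, pos)`. [cite: Umans2003, §6 ("by the symmetry of `G_x`")] -/
theorem binGen_shift (xs : List Bool) (m : ℕ) (y : LF cap a M d) (pos : GF2 M × Fin (2 ^ (M + 1))) :
    QConv.binGen (labM M) (V.GF xs (m + 2)) (y, pos) 1 = QConv.binGen (labM M) (V.GF xs (m + 2)) (αL cap a M d * y, pos) 0 := by
  show QConv.cw (labM M) (V.GF xs (m + 2) y 1) pos = QConv.cw (labM M) (V.GF xs (m + 2) (αL cap a M d * y) 0) pos
  have h : V.GF xs (m + 2) y 1 = V.GF xs (m + 2) (αL cap a M d * y) 0 := by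
    funext j
    simp only [GF, UmansEnc.qGen, Fin.val_one, Fin.val_zero, zero_add, pow_succ, pow_zero, one_mul, mul_assoc]
  rw [h]

set_option maxHeartbeats 400000 in
open Classical in
/-- **From a distinguisher to a dense next-element predictor** (Yao's lemma + Lemma 13): a circuit
`C` on `m = m' + 2` bits with advantage `> 1/m` against the binary generator (seeds parsed by
`seedθ`) yields a position `j ≥ 1`, a circuit `C'` (`C` with at most one input hard-wired), a sign
and coins such that the next-element list predictor `predG` (thresholds `D₁`, `A₁` with
`m²(A₁ 2^b + q D₁) ≤ q 2^b`) succeeds on at least `|L|/m² - 1` seeds: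
`|L| ≤ m² (#goodSeeds + 1)`. [cite: Umans2003, Lemma 13, Thm. 14 (proof, "suppose `C` ε-distinguishes …"), §6] -/
theorem exists_dense_predictor (xs : List Bool) (m' : ℕ) (C : Circuit (Fin (m' + 2))) (hC : C.IsOver B2) {D₁ A₁ : ℕ}
    (hAD : (m' + 2) ^ 2 * (A₁ * 2 ^ (M + 1) + 2 ^ (M + 1) * D₁) ≤ 2 ^ (M + 1) * 2 ^ (M + 1))
    (hadv : (1 : ℝ) / (m' + 2) < MetaComplexity.prgAdvantage C
      (fun v : Fin ((d + 2) * (M + 1)) → Bool => QConv.binGen (labM M) (V.GF xs (m' + 2)) (V.seedθ v))) :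
    ∃ (j : Fin (m' + 2)) (C' : Circuit (Fin (m' + 2))) (sgn : Bool) (wc : Fin (m' + 2) → Bool),
      1 ≤ (j : ℕ) ∧ C'.IsOver B2 ∧ C'.size ≤ C.size + 1 ∧
      Fintype.card (LF cap a M d) ≤ (m' + 2) ^ 2 *
        ((UmansRec.Ctx.goodSeeds (K := GF2 M) ⟨j, V.EF xs, αL cap a M d, frob cap a M d ^ (d - 1),
          predG (NB V.hlen) C'.eval j sgn wc D₁ A₁⟩).card + 1) := by
  set S := LF cap a M d × (GF2 M × Fin (2 ^ (M + 1)))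
  set Gb : S → Fin (m' + 2) → Bool := QConv.binGen (labM M) (V.GF xs (m' + 2)) with hGb
  set T : (Fin (m' + 2) → Bool) → Bool := C.eval with hT
  have hmpos : (0 : ℝ) < (m' + 2 : ℕ) := by positivity
  have hm0 : 0 < m' + 2 := by omega
  -- (1) the advantage as a count inequality over `S`
  have hS : Fintype.card S = 2 ^ ((d + 2) * (M + 1)) := by
    rw [← V.card_seed_eq, Fintype.card_fun, Fintype.card_bool, Fintype.card_fin]
  set a₁ := (univ.filter fun sp : S => T (Gb sp) = true).card with ha₁
  set a₂ := (univ.filter fun w : Fin (m' + 2) → Bool => T w = true).card with ha₂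
  have ha₁' : (univ.filter fun v : Fin ((d + 2) * (M + 1)) → Bool => T (Gb (V.seedθ v)) = true).card = a₁ := by
    rw [ha₁, ← Finset.card_map V.seedθ.toEmbedding]
    congr 1
    ext sp
    simp only [mem_map_equiv, mem_filter, mem_univ, true_and, Equiv.apply_symm_apply]
  have hSpos : (0 : ℝ) < Fintype.card S := Nat.cast_pos.2 Fintype.card_pos
  have h2m : (0 : ℝ) < (2 : ℝ) ^ (m' + 2) := by positivity
  have hgap : ((2 : ℝ) ^ (m' + 2) * (Fintype.card S : ℝ)) / (m' + 2 : ℕ) < |(2 : ℝ) ^ (m' + 2) * a₁ - (Fintype.card S : ℝ) * a₂| := by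
    have hprg : MetaComplexity.prgAdvantage C (fun v : Fin ((d + 2) * (M + 1)) → Bool => Gb (V.seedθ v)) =
        |(a₁ : ℝ) / Fintype.card S - (a₂ : ℝ) / 2 ^ (m' + 2)| := by
      rw [MetaComplexity.prgAdvantage, ha₁', hS]; push_cast; rfl
    have hadv' : (1 : ℝ) / (m' + 2 : ℕ) < |(a₁ : ℝ) / Fintype.card S - (a₂ : ℝ) / 2 ^ (m' + 2)| := by
      rw [← hprg]; push_cast; exact hadv
    have e : (2 : ℝ) ^ (m' + 2) * a₁ - (Fintype.card S : ℝ) * a₂ =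
        (2 ^ (m' + 2) * Fintype.card S) * ((a₁ : ℝ) / Fintype.card S - (a₂ : ℝ) / 2 ^ (m' + 2)) := by
      field_simp
    rw [e, abs_mul, abs_of_pos (by positivity)]
    calc ((2 : ℝ) ^ (m' + 2) * (Fintype.card S : ℝ)) / (m' + 2 : ℕ) = (2 ^ (m' + 2) * Fintype.card S) * (1 / (m' + 2 : ℕ)) := by ring
      _ < (2 ^ (m' + 2) * Fintype.card S) * |(a₁ : ℝ) / Fintype.card S - (a₂ : ℝ) / 2 ^ (m' + 2)| :=
        mul_lt_mul_of_pos_left hadv' (by positivity)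
  -- (2) Yao's next-bit predictor: any triple satisfying Yao's inequality has many agreements
  have hagree : ∀ (T₁ : (Fin (m' + 2) → Bool) → Bool) (j : Fin (m' + 2)) (sgn : Bool) (w : Fin (m' + 2) → Bool),
      2 * |(2 : ℤ) ^ (m' + 2) * a₁ - (Fintype.card S : ℤ) * a₂| ≤
        (m' + 2 : ℕ) * 2 ^ (m' + 2) * (2 * ((univ.filter fun s : S => YaoNB.pred T₁ j sgn w (Gb s) = Gb s j).card : ℤ) - Fintype.card S) →
      (2 * (Fintype.card S : ℝ)) / (m' + 2 : ℕ) ^ 2 < 2 * ((univ.filter fun s : S => YaoNB.pred T₁ j sgn w (Gb s) = Gb s j).card : ℝ) - Fintype.card S := by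
    intro T₁ j sgn w h
    set agr := (univ.filter fun s : S => YaoNB.pred T₁ j sgn w (Gb s) = Gb s j).card with hagr
    have h' : 2 * |(2 : ℝ) ^ (m' + 2) * a₁ - (Fintype.card S : ℝ) * a₂| ≤ (m' + 2 : ℕ) * 2 ^ (m' + 2) * (2 * (agr : ℝ) - Fintype.card S) := by
      have := (Int.cast_le (R := ℝ)).2 h
      push_cast at this ⊢
      exact this
    have h2 : 2 * (((2 : ℝ) ^ (m' + 2) * (Fintype.card S : ℝ)) / (m' + 2 : ℕ)) < (m' + 2 : ℕ) * 2 ^ (m' + 2) * (2 * (agr : ℝ) - Fintype.card S) :=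
      lt_of_lt_of_le (by linarith [hgap]) h'
    have e : (2 * (Fintype.card S : ℝ)) / (m' + 2 : ℕ) ^ 2 = (2 * ((2 ^ (m' + 2) * (Fintype.card S : ℝ)) / (m' + 2 : ℕ))) / ((m' + 2 : ℕ) * 2 ^ (m' + 2)) := by
      field_simp
    rw [e, div_lt_iff₀ (by positivity)]
    linarith
  obtain ⟨j, sgn, w, hyao⟩ := YaoNB.yao_nextBit Gb T hm0
  have hyao' := hagree T j sgn w hyao
  -- (3) move off position `0`
  obtain ⟨j', C', sgn', w', hj', hC', hsize, hagree'⟩ : ∃ (j' : Fin (m' + 2)) (C' : Circuit (Fin (m' + 2))) (sgn' : Bool) (w' : Fin (m' + 2) → Bool),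
      1 ≤ (j' : ℕ) ∧ C'.IsOver B2 ∧ C'.size ≤ C.size + 1 ∧
      (2 * (Fintype.card S : ℝ)) / (m' + 2 : ℕ) ^ 2 < 2 * ((univ.filter fun s : S => YaoNB.pred C'.eval j' sgn' w' (Gb s) = Gb s j').card : ℝ) - Fintype.card S := by
    by_cases hj0 : (j : ℕ) = 0
    · obtain ⟨C', hC'1, hC'2, hC'3⟩ := exists_fixInput C hC (w 0)
      have hsh := bump_predictor Gb T sgn w
        ((Equiv.mulLeft₀ (αL cap a M d) V.αL_ne_zero).prodCongr (Equiv.refl _)) (fun s => by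
          obtain ⟨y, pos⟩ := s
          exact V.binGen_shift xs m' y pos)
      refine ⟨1, C', sgn ^^ (w 0 ^^ w 1), w, by simp, hC'1, hC'2, ?_⟩
      have hev : C'.eval = fun v => T fun i => if i = 0 then w 0 else v i := funext hC'3
      rw [hev]
      have hsh' : (univ.filter fun s : S => YaoNB.pred (fun v => T fun i => if i = 0 then w 0 else v i) 1 (sgn ^^ (w 0 ^^ w 1)) w (Gb s) = Gb s 1).card =
          (univ.filter fun s : S => YaoNB.pred T 0 sgn w (Gb s) = Gb s 0).card := hsh
      rw [hsh']
      have hj00 : j = 0 := Fin.ext hj0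
      rw [hj00] at hyao'
      exact hyao'
    · exact ⟨j, C, sgn, w, Nat.pos_of_ne_zero hj0, hC, Nat.le_succ _, hyao'⟩
  refine ⟨j', C', sgn', w', hj', hC', hsize, ?_⟩
  -- (4) the list predictor succeeds (Lemma 13)
  set P : (Fin (m' + 2) → Bool) → Bool := YaoNB.pred C'.eval j' sgn' w' with hP
  set agree := (univ.filter fun s : S => YaoNB.pred C'.eval j' sgn' w' (Gb s) = Gb s j').card with hagreedef
  have hagree_eq : (univ.filter fun sp : S => P (fun k => if (k : ℕ) < (j' : ℕ) then QConv.binGen (labM M) (V.GF xs (m' + 2)) sp k else false) =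
      QConv.binGen (labM M) (V.GF xs (m' + 2)) sp j').card = agree := by
    rw [hagreedef]
    congr 1
    ext sp
    simp only [mem_filter, mem_univ, true_and]
    rw [hP, ← pred_prefix]
  have hSLK : Fintype.card S = Fintype.card (LF cap a M d) * (Fintype.card (GF2 M) * 2 ^ (M + 1)) := by
    rw [Fintype.card_prod, Fintype.card_prod, Fintype.card_fin]
  have h2agree : Fintype.card S ≤ 2 * agree := by
    have : (Fintype.card S : ℝ) < 2 * agree := by
      have h0 : (0 : ℝ) ≤ (2 * (Fintype.card S : ℝ)) / (m' + 2 : ℕ) ^ 2 := by positivity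
      linarith [hagree']
    exact_mod_cast this.le
  set E := (2 * agree - Fintype.card S) / 2 with hE
  have hPhyp : Fintype.card (LF cap a M d) * (Fintype.card (GF2 M) * 2 ^ (M + 1)) + 2 * E ≤
      2 * (univ.filter fun sp : S => P (fun k => if (k : ℕ) < (j' : ℕ) then QConv.binGen (labM M) (V.GF xs (m' + 2)) sp k else false) =
        QConv.binGen (labM M) (V.GF xs (m' + 2)) sp j').card := by
    rw [hagree_eq, ← hSLK, hE]; omega
  have hLP := QConv.listPred_success (labM M) (V.GF xs (m' + 2)) P j' (D := D₁) (A := A₁) hPhyp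
  -- (5) the successful seeds are the good seeds of the context
  set X : UmansRec.Ctx (GF2 M) (LF cap a M d) :=
    ⟨j', V.EF xs, αL cap a M d, frob cap a M d ^ (d - 1), predG (NB V.hlen) C'.eval j' sgn' w' D₁ A₁⟩ with hX
  have hgood : (univ.filter fun y : LF cap a M d => V.GF xs (m' + 2) y j' ∈ QConv.listPred (labM M) P j' D₁ A₁ (V.GF xs (m' + 2) y)) = X.goodSeeds := by
    ext y
    rw [UmansRec.Ctx.goodSeeds, mem_filter, mem_filter]
    simp only [mem_univ, true_and]
    have hzs : ∀ k : Fin (m' + 2), (k : ℕ) < (j' : ℕ) →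
        zsOf (NB V.hlen) (fun k : Fin (j' : ℕ) => V.EF xs (αL cap a M d ^ ((k : ℕ) + 1) * y)) k = V.GF xs (m' + 2) y k := by
      intro k hk
      funext i
      rw [zsOf, dif_pos hk, GF, UmansEnc.qGen, EF]
    have hg : X.g (fun k : Fin X.n₀ => X.E (X.α ^ ((k : ℕ) + 1) * y)) =
        (QConv.listPred (labM M) P j' D₁ A₁ (V.GF xs (m' + 2) y)).image (vecToL (NB V.hlen)) := by
      show predG (NB V.hlen) C'.eval j' sgn' w' D₁ A₁ (fun k : Fin (j' : ℕ) => V.EF xs (αL cap a M d ^ ((k : ℕ) + 1) * y)) = _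
      rw [predG, listPred_congr (labM M) _ j' D₁ A₁ hzs]
    have hEq : X.E (X.α ^ (X.n₀ + 1) * y) = vecToL (NB V.hlen) (V.GF xs (m' + 2) y j') := by
      show V.EF xs (αL cap a M d ^ ((j' : ℕ) + 1) * y) = vecToL (NB V.hlen) (fun i => (NB V.hlen).coord i (UmansEnc.qGen (βL cap a M d) (V.φF xs) (αL cap a M d) (m' + 2) y j'))
      rw [V.vecToL_coord]; rfl
    rw [hg, hEq, mem_image]
    constructor
    · intro h; exact ⟨_, h, rfl⟩
    · rintro ⟨z, hz, hzv⟩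
      rw [vecToL_injective (NB V.hlen) hzv] at hz; exact hz
  rw [hgood] at hLP
  -- (6) the final count
  set good := X.goodSeeds.card with hgooddef
  set Lr : ℝ := (Fintype.card (LF cap a M d) : ℝ) with hLr
  set Q : ℝ := (2 : ℝ) ^ (M + 1) * 2 ^ (M + 1) with hQ
  set W : ℝ := (A₁ : ℝ) * 2 ^ (M + 1) + 2 ^ (M + 1) * (D₁ : ℝ) with hW
  set mr : ℝ := ((m' + 2 : ℕ) : ℝ) with hmr
  have hSreal : (Fintype.card S : ℝ) = Lr * Q := by
    rw [hSLK, card_GF2, hLr, hQ]; push_cast; ring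
  have hE2 : (2 * agree : ℝ) - Fintype.card S - 1 ≤ 2 * E := by
    have hx : ∀ x : ℕ, x - 1 ≤ 2 * (x / 2) := fun x => by omega
    have h1 : 2 * agree - Fintype.card S - 1 ≤ 2 * E := by rw [hE]; exact hx _
    have h' := (Nat.cast_le (α := ℝ)).2 h1
    have h3 : ((2 * agree - Fintype.card S - 1 : ℕ) : ℝ) ≥ (2 * agree : ℝ) - Fintype.card S - 1 := by
      rcases Nat.lt_or_ge (2 * agree - Fintype.card S) 1 with hlt | hge
      · have : ((2 * agree - Fintype.card S - 1 : ℕ) : ℝ) = 0 := by rw [Nat.sub_eq_zero_of_le (by omega)]; simp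
        rw [this]
        have : (2 * agree : ℝ) - Fintype.card S ≤ 1 := by
          have := (Nat.cast_le (α := ℝ)).2 (show 2 * agree ≤ Fintype.card S + 1 by omega); push_cast at this; linarith
        linarith
      · rw [Nat.cast_sub hge, Nat.cast_sub h2agree]; push_cast; linarith
    push_cast at h'
    linarith
  have hLPr : (2 * E : ℝ) ≤ good * Q + Lr * W := by
    have := (Nat.cast_le (α := ℝ)).2 hLP
    rw [card_GF2] at this
    push_cast at this
    rw [hQ, hW, hLr]; linarith
  have hADr : mr ^ 2 * W ≤ Q := by
    have := (Nat.cast_le (α := ℝ)).2 hAD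
    push_cast at this
    rw [hmr, hW, hQ]; push_cast; linarith
  have hmr0 : 0 < mr := by rw [hmr]; positivity
  have hQ1 : 1 ≤ Q := by rw [hQ]; exact one_le_mul_of_one_le_of_one_le (one_le_pow₀ (by norm_num)) (one_le_pow₀ (by norm_num))
  have hL0 : 0 ≤ Lr := by rw [hLr]; exact Nat.cast_nonneg _
  have hg0 : (0 : ℝ) ≤ good := Nat.cast_nonneg _
  -- `2 Lr Q / mr² - 1 < good Q + Lr W`
  have h5 : 2 * (Lr * Q) / mr ^ 2 - 1 < good * Q + Lr * W := by
    rw [← hSreal]; linarith [hagree', hE2, hLPr]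
  -- multiply by `mr²`
  have h6 : 2 * (Lr * Q) - mr ^ 2 < mr ^ 2 * (good * Q) + Lr * (mr ^ 2 * W) := by
    have hm2 : 0 < mr ^ 2 := by positivity
    have := mul_lt_mul_of_pos_right h5 hm2
    have e : (2 * (Lr * Q) / mr ^ 2 - 1) * mr ^ 2 = 2 * (Lr * Q) - mr ^ 2 := by field_simp
    rw [e] at this
    linarith [this]
  have h7 : Lr * (mr ^ 2 * W) ≤ Lr * Q := mul_le_mul_of_nonneg_left hADr hL0
  have hmQ : mr ^ 2 ≤ mr ^ 2 * Q := le_mul_of_one_le_right (by positivity) hQ1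
  have h8 : Lr * Q < mr ^ 2 * ((good : ℝ) + 1) * Q := by linarith [h6, h7, hmQ]
  have key' : Lr < mr ^ 2 * ((good : ℝ) + 1) := lt_of_mul_lt_mul_right h8 (by positivity)
  have : Fintype.card (LF cap a M d) < (m' + 2) ^ 2 * (good + 1) := by
    rw [hLr, hmr] at key'
    exact_mod_cast key'
  exact this.le

end Main

end PrmOK

/-! ## Part 2: the reconstruction context of the found field data -/

namespace PrmOK

section Recon

variable {cap a M d c0 : ℕ} [hirr : Fact (Irreducible (pOf M (pcOf cap a M d)))]
variable (V : PrmOK cap a M d c0)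
include V

/-- **The reconstruction context of the generator**: `n₀ = j`, `Ẽ = EF xs`, `α`, `σ = frob^{d-1}`,
`g = predG` (the list predictor from the circuit `C'`). [cite: Umans2003, Thm. 14 (proof), §6] -/
def XC (xs : List Bool) {m : ℕ} (C' : Circuit (Fin m)) (j : Fin m) (sgn : Bool) (wc : Fin m → Bool) (D₁ A₁ : ℕ) :
    UmansRec.Ctx (GF2 M) (LF cap a M d) := by
  classical exact ⟨j, V.EF xs, αL cap a M d, frob cap a M d ^ (d - 1), predG (NB V.hlen) (fun x => C'.eval x) j sgn wc D₁ A₁⟩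

variable (xs : List Bool) {m : ℕ} (C' : Circuit (Fin m)) (j : Fin m) (sgn : Bool) (wc : Fin m → Bool) (D₁ A₁ : ℕ)

/-- The fields of the context. [folklore] -/
theorem XC_n₀ : (V.XC xs C' j sgn wc D₁ A₁).n₀ = j := rfl
/-- The fields of the context. [folklore] -/
theorem XC_E : (V.XC xs C' j sgn wc D₁ A₁).E = V.EF xs := rfl
/-- The fields of the context. [folklore] -/
theorem XC_α : (V.XC xs C' j sgn wc D₁ A₁).α = αL cap a M d := rfl
/-- The fields of the context. [folklore] -/
theorem XC_σ : (V.XC xs C' j sgn wc D₁ A₁).σ = frob cap a M d ^ (d - 1) := rfl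
/-- The fields of the context. [folklore] -/
theorem XC_g : (V.XC xs C' j sgn wc D₁ A₁).g = by classical exact predG (NB V.hlen) (fun x => C'.eval x) j sgn wc D₁ A₁ := rfl

/-- **(P1*) The coordinates of `Ẽ` have low degree along curves**: `Dφ = d (h - 1)`.
[cite: Umans2003, Thm. 8 (P1), Def. 9 (P1*)] -/
theorem XC_hE (jj : Fin d) : UmansEnc.CurveDeg (d * (2 ^ a - 1)) fun u => (NB V.hlen).coord jj ((V.XC xs C' j sgn wc D₁ A₁).E u) := by
  classical
  rw [XC_E]
  have hφ : UmansEnc.CurveDeg (d * (2 ^ a - 1)) (V.φF xs) := by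
    have := UmansEnc.curveDeg_lde (NB V.hlen) (HF cap a M) (UmansEnc.placedTable (NB V.hlen) (HF cap a M) (posF cap a M d xs.length) (tabK M xs))
    rw [V.card_HF] at this
    exact this
  exact UmansEnc.curveDeg_apply_augE hφ ((NB V.hlen).coord jj) (βL cap a M d)

/-- **`σᵈ = 1`.** [cite: Umans2003, §6.3] -/
theorem XC_hσ : (V.XC xs C' j sgn wc D₁ A₁).σ ^ d = 1 := by
  rw [XC_σ, ← pow_mul, mul_comm, pow_mul, V.frob_pow_d, one_pow]

/-- **`σ α = α^{q'}`** with `q' = q^{d-1}`. [cite: Umans2003, §6.3] -/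
theorem XC_hσα : (V.XC xs C' j sgn wc D₁ A₁).σ (V.XC xs C' j sgn wc D₁ A₁).α = (V.XC xs C' j sgn wc D₁ A₁).α ^ ((2 ^ (M + 1)) ^ (d - 1)) := by
  rw [XC_σ, XC_α, frob_pow_apply]

/-- **`Ẽ` commutes with `σ`.** [cite: Umans2003, Def. 9 (equivariance)] -/
theorem XC_hEσ (u : LF cap a M d) : (V.XC xs C' j sgn wc D₁ A₁).E ((V.XC xs C' j sgn wc D₁ A₁).σ u) =
    (V.XC xs C' j sgn wc D₁ A₁).σ ((V.XC xs C' j sgn wc D₁ A₁).E u) := by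
  rw [XC_E, XC_σ, EF]
  exact UmansEnc.augE_equivariant _ _ _ _

omit V hirr in
/-- `q^d ≡ 1 (mod q^d - 1)` (as `(P + 1) % P = 1 % P`). [folklore] -/
theorem _root_.Literature.Computability.Complexity.UmansFP.qd_mod' (M d : ℕ) : ((2 ^ (M + 1)) ^ d) % ((2 ^ (M + 1)) ^ d - 1) = 1 % ((2 ^ (M + 1)) ^ d - 1) := by
  set P := (2 ^ (M + 1)) ^ d - 1 with hP
  have h1 : 1 ≤ (2 ^ (M + 1)) ^ d := Nat.one_le_pow _ _ (Nat.two_pow_pos _)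
  have e : (2 ^ (M + 1)) ^ d = P + 1 := by rw [hP]; omega
  rw [e, Nat.add_mod, Nat.mod_self, zero_add, Nat.mod_mod]

omit V hirr in
/-- `q q' ≡ 1 (mod q^d - 1)`. [folklore] -/
theorem qq'_mod (hd : 1 ≤ d) : (2 ^ (M + 1) * (2 ^ (M + 1)) ^ (d - 1)) % ((2 ^ (M + 1)) ^ d - 1) = 1 % ((2 ^ (M + 1)) ^ d - 1) := by
  have e : 2 ^ (M + 1) * (2 ^ (M + 1)) ^ (d - 1) = (2 ^ (M + 1)) ^ d := by
    rw [← pow_succ', Nat.sub_add_cancel hd]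
  rw [e]
  exact qd_mod' M d


omit V hirr in
/-- `q^d ≡ 1 (mod q^d - 1)`. [folklore] -/
theorem qd_mod : ((2 ^ (M + 1)) ^ d) % ((2 ^ (M + 1)) ^ d - 1) = 1 % ((2 ^ (M + 1)) ^ d - 1) := qd_mod' M d

/-- Every nonzero element is a power of `α`. [cite: Umans2003, §4.1] -/
theorem XC_hαgen (u : LF cap a M d) (hu : u ≠ 0) : ∃ n : ℕ, (V.XC xs C' j sgn wc D₁ A₁).α ^ n = u := by
  obtain ⟨k, -, hk⟩ := V.αL_gen u hu
  exact ⟨k, hk⟩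

/-- **The predictor's outputs are short**: `|g(w)| ≤ J₁ - 1 ≤ max 1 cap₁`. [cite: Umans2003, Lemma 13] -/
theorem XC_hg {I₁ J₁ cap₁ ℓ₁ : ℕ} (hD₁ : 1 ≤ D₁) (hℓ : 4 ^ (M + 1) ≤ ℓ₁ * D₁ ^ 2) (hIJ₁ : 2 ^ (M + 1) * ℓ₁ < I₁ * J₁)
    (hA₁ : (I₁ - 1) + (J₁ - 1) * (d - 1) < A₁) (hcap₁ : J₁ ≤ cap₁) (w : Fin (V.XC xs C' j sgn wc D₁ A₁).n₀ → LF cap a M d) :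
    ((V.XC xs C' j sgn wc D₁ A₁).g w).card ≤ max 1 cap₁ := by
  classical
  rw [XC_g]
  show ((QConv.listPred (labM M) (YaoNB.pred (fun x => C'.eval x) j sgn wc) j D₁ A₁ (zsOf (NB V.hlen) w)).image (vecToL (NB V.hlen))).card ≤ _
  refine (card_image_le).trans ((QConv.listPred_card_le (labM M) _ j hD₁ ?_ hA₁ _).trans ?_)
  · refine lt_of_le_of_lt (Nat.mul_le_mul_left _ ?_) (by rw [card_GF2]; exact hIJ₁)
    exact Nat.div_le_of_le_mul (by rw [mul_comm]; exact hℓ)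
  · omega

open Classical in
/-- **Thm. 14 for the generator's context**: under the numeric hypotheses, there are good curves
`b, v` and an offset `c⋆` such that the reconstruction walk fed the base-`q` digits of any `z < q^d`
outputs `Ẽ(α^{z + c⋆ + 1})`. [cite: Umans2003, Thm. 14, §6.3] -/
theorem recon_advice (hj : 0 < (j : ℕ)) {r' : ℕ} (hr : Even ((d + 1) * r')) (hr' : 0 < r')
    {D A I J : ℕ} {I₁ J₁ cap₁ ℓ₁ : ℕ} (hD₁ : 1 ≤ D₁) (hℓ : 4 ^ (M + 1) ≤ ℓ₁ * D₁ ^ 2) (hIJ₁ : 2 ^ (M + 1) * ℓ₁ < I₁ * J₁)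
    (hA₁ : (I₁ - 1) + (J₁ - 1) * (d - 1) < A₁) (hcap₁ : J₁ ≤ cap₁)
    (hIJ : 2 ^ (M + 1) * (max 1 cap₁) < I * J) (hAIJ : (I - 1) + (J - 1) * D < A)
    (hD : d * (2 ^ a - 1) * ((d + 1) * r' - 1) ≤ D) (hDq : D < 2 ^ (M + 1)) {μ : ℝ}
    (hμ : μ = ((2 ^ (M + 1) : ℕ) : ℝ) * ((V.XC xs C' j sgn wc D₁ A₁).goodSeeds.card : ℝ) / Fintype.card (LF cap a M d))
    (hAμ : 2 * (A : ℝ) ≤ μ) (hμ1 : 1 ≤ μ)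
    (hsmall : (((2 ^ (M + 1)) ^ d - 1 : ℕ) : ℝ) * d *
        (2 * (Fintype.card (UmansRec.Idx d r' ↪ GF2 M) : ℝ) *
            (2 ^ ((d + 1) * r') * ((((d + 1) * r' / 2 : ℕ) + 1 : ℝ) * (((d + 1) * r' / 2 : ℕ) : ℝ) ^ ((d + 1) * r') *
              μ ^ ((d + 1) * r' / 2))) / μ ^ ((d + 1) * r') +
          2 * d * ((J - 1 : ℕ) : ℝ) * ((D : ℝ) ^ r' * ((2 ^ (M + 1) : ℕ) : ℝ) ^ (d * r'))) +
        (Fintype.card (UmansRec.Idx d r' ↪ GF2 M) : ℝ) / Fintype.card (LF cap a M d) <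
        Fintype.card (UmansRec.Idx d r' ↪ GF2 M)) :
    ∃ (b : UmansRec.Idx d r' ↪ GF2 M) (v : UmansRec.Idx d r' → LF cap a M d) (cstar : ℕ),
      (V.XC xs C' j sgn wc D₁ A₁).Good (NB V.hlen) D A ((2 ^ (M + 1)) ^ d - 1) b v ∧
      UmansEnc.curvePt ((V.XC xs C' j sgn wc D₁ A₁).C₁ b v) (0 : GF2 M) = αL cap a M d ^ cstar ∧
        ∀ z : ℕ, z < (2 ^ (M + 1)) ^ d →
          (V.XC xs C' j sgn wc D₁ A₁).reconstruct (NB V.hlen) D A hj b (2 ^ (M + 1)) ((2 ^ (M + 1)) ^ (d - 1)) ((2 ^ (M + 1)) ^ d - 1)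
              (((j : ℕ) + 1) * 2 ^ (M + 1)) (fun c => z / (2 ^ (M + 1)) ^ c % 2 ^ (M + 1))
            ((V.XC xs C' j sgn wc D₁ A₁).trueState b 0 0 v) = V.EF xs (αL cap a M d ^ (z + cstar + 1)) := by
  have hP0 : 0 < (2 ^ (M + 1)) ^ d - 1 := Nat.sub_pos_of_lt (Nat.one_lt_pow (by have := V.hd; omega) (Nat.one_lt_two_pow (by omega)))
  have hq : 0 < 2 ^ (M + 1) := Nat.two_pow_pos _
  have h := UmansRec.Ctx.thm14_advice (V.XC xs C' j sgn wc D₁ A₁) (NB V.hlen) D A (V.XC_hE xs C' j sgn wc D₁ A₁) V.αL_ne_zero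
    (V.XC_hαgen xs C' j sgn wc D₁ A₁) hr hr' (P := (2 ^ (M + 1)) ^ d - 1) V.αL_pow_P hP0
    (V.XC_hg xs C' j sgn wc D₁ A₁ hD₁ hℓ hIJ₁ hA₁ hcap₁) (by rw [card_GF2]; exact hIJ) hAIJ hD (by rw [card_GF2]; exact hDq)
    (by rw [hμ, card_GF2]) hAμ hμ1 (by rw [card_GF2]; exact hsmall) (V.XC_hσ xs C' j sgn wc D₁ A₁) hj
    (q := 2 ^ (M + 1)) (q' := (2 ^ (M + 1)) ^ (d - 1)) (V.XC_hσα xs C' j sgn wc D₁ A₁) (V.XC_hEσ xs C' j sgn wc D₁ A₁) (qq'_mod V.hd) qd_mod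
    (T := ((j : ℕ) + 1) * 2 ^ (M + 1)) (by rw [XC_n₀]; exact Nat.le_add_left _ _) hq
  obtain ⟨b, v, cstar, hgood, hC0, hrec⟩ := h
  exact ⟨b, v, cstar, hgood, hC0, fun z hz => by rw [hrec z hz]; rfl⟩

end Recon

/-! ### The advice of the reconstruction machine and its correctness -/

section Advice

variable {cap a M d c0 : ℕ} [hirr : Fact (Irreducible (pOf M (pcOf cap a M d)))]
variable (V : PrmOK cap a M d c0)

/-- **A table of a value function** `U : K → L`: row `bb` is the representative of `U(elt bb)`. [folklore] -/
def tabOf (U : GF2 M → LF cap a M d) : Tab := (List.range (2 ^ (M + 1))).map fun bb => reprL V.hlen (U (GF2.elt M bb))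

/-- The tables of a window. [folklore] -/
def winOf {n₀ : ℕ} (W : Fin n₀ → GF2 M → LF cap a M d) : List Tab := List.ofFn fun k => V.tabOf (W k)

/-- **The machine state of a walk state.** [folklore] -/
def stOf {n₀ : ℕ} (stm : UmansRec.Ctx.WState (GF2 M) (LF cap a M d) n₀) : WStateL := (stm.1, V.winOf stm.2.1, V.winOf stm.2.2)

/-- **The node lists** of the node embedding `b`. [folklore] -/
def bnOf {r' : ℕ} (b : UmansRec.Idx d r' ↪ GF2 M) : List (List ℕ) :=
  List.ofFn fun e : Fin (d + 1) => List.ofFn fun k : Fin r' => toBits M (b (e, k))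

/-- **The readout coefficients**: the first normal-basis coordinate functional on the power basis. [cite: Umans2003, Def. 9 (P2*)] -/
def clOf : List ℕ := List.ofFn fun jj : Fin d => toBits M (V.NN.coord 1 (NB V.hlen jj))

/-- **The readout bit** of a reconstructed coordinate list. [cite: Umans2003, Def. 9 (P2*), Thm. 14 ("output `p₀(…)`")] -/
def readoutBit (u : List ℕ) : Bool := kdot (kctx M) u V.clOf == 1

/-- The base-`q` digits of `z` (`d` of them). [cite: Umans2003, §6.3] -/
def _root_.Literature.Computability.Complexity.UmansFP.digitsOf (M d z : ℕ) : List ℕ := (List.range d).map fun c => z / (2 ^ (M + 1)) ^ c % 2 ^ (M + 1)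

/-- The exponent offset of position `i`: `z` with `z + c⋆ + 1 ≡ r i (mod q^d - 1)`. [cite: Umans2003, §6.3] -/
def _root_.Literature.Computability.Complexity.UmansFP.zOf (a M d cstar i : ℕ) : ℕ :=
  (rOf a M d * i + (((2 ^ (M + 1)) ^ d - 1) - (cstar + 1) % ((2 ^ (M + 1)) ^ d - 1))) % ((2 ^ (M + 1)) ^ d - 1)

include V

/-- Tables are faithful. [folklore] -/
theorem tabOf_ok (U : GF2 M → LF cap a M d) : TabOKq d (ρN (NB V.hlen)) (V.tabOf U) U := by
  refine ⟨fun bb hbb => ?_, by rw [tabOf, List.length_map, List.length_range]⟩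
  rw [tabOf, List.getD_eq_getElem _ _ (by rw [List.length_map, List.length_range]; exact hbb), List.getElem_map, List.getElem_range]
  exact ⟨reprL_rep V.hlen _, by rw [← lElt_eq_ρN V.hlen (by rw [(reprL_rep V.hlen _).1]), lElt_reprL]⟩

/-- Windows are faithful. [folklore] -/
theorem winOf_ok {n₀ : ℕ} (W : Fin n₀ → GF2 M → LF cap a M d) : WinOK d (ρN (NB V.hlen)) (V.winOf W) W := by
  refine ⟨List.length_ofFn, fun k => ?_⟩
  rw [winOf, List.getD_eq_getElem _ _ (by rw [List.length_ofFn]; exact k.2), List.getElem_ofFn]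
  exact V.tabOf_ok (W k)

/-- States are faithful. [folklore] -/
theorem stOf_ok {n₀ : ℕ} (stm : UmansRec.Ctx.WState (GF2 M) (LF cap a M d) n₀) : StateOK d (ρN (NB V.hlen)) (V.stOf stm) stm :=
  ⟨rfl, V.winOf_ok _, V.winOf_ok _⟩

omit V in
/-- Node lists are faithful. [folklore] -/
theorem bnOf_ok {r' : ℕ} (b : UmansRec.Idx d r' ↪ GF2 M) : NodesOK (M := M) (bnOf b) b := by
  intro e he
  have hrow : (bnOf (M := M) b).getD e [] = List.ofFn fun k : Fin r' => toBits M (b (⟨e, he⟩, k)) := by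
    rw [bnOf, List.getD_eq_getElem _ _ (by rw [List.length_ofFn]; exact he), List.getElem_ofFn]
  refine ⟨by rw [hrow, List.length_ofFn], fun k => ?_⟩
  rw [hrow, List.getD_eq_getElem _ _ (by rw [List.length_ofFn]; exact k.2), List.getElem_ofFn]
  exact ⟨toBits_lt M _, elt_toBits M _⟩

/-- The `σ`-program is faithful: `lsqIter` by `(M+1)(d-1)` squarings is `frob^{d-1}`. [cite: Umans2003, §6.3] -/
theorem sigOK (xs : List Bool) {m : ℕ} (C' : Circuit (Fin m)) (j : Fin m) (sgn : Bool) (wc : Fin m → Bool) (D₁ A₁ : ℕ) :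
    SigOK d (V.XC xs C' j sgn wc D₁ A₁) (ρN (NB V.hlen)) fun u => lsqIter (kctx M) (pcOf cap a M d) u ((M + 1) * (d - 1)) := by
  intro u hu
  obtain ⟨h1, h2⟩ := lsqIter_spec M V.pc_spec.1 V.hd hu ((M + 1) * (d - 1))
  refine ⟨h1, ?_⟩
  rw [← lElt_eq_ρN V.hlen (by rw [h1.1]), ← lElt_eq_ρN V.hlen (by rw [hu.1]), h2, XC_σ, frob_pow_apply, pow_mul]

/-- Powers of `α` depend on the exponent modulo `P = q^d - 1`. [folklore] -/
theorem αL_pow_mod (n : ℕ) : αL cap a M d ^ n = αL cap a M d ^ (n % ((2 ^ (M + 1)) ^ d - 1)) := by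
  conv_lhs => rw [← Nat.mod_add_div n ((2 ^ (M + 1)) ^ d - 1), pow_add, pow_mul, V.αL_pow_P, one_pow, mul_one]

/-- **The offset of position `i` hits the position**: `α^{zOf i + c⋆ + 1} = γⁱ`. [cite: Umans2003, §6.3] -/
theorem αL_pow_zOf (cstar i : ℕ) : αL cap a M d ^ (zOf a M d cstar i + cstar + 1) = γL cap a M d ^ i := by
  set P := (2 ^ (M + 1)) ^ d - 1 with hP
  have hP0 : 0 < P := Nat.sub_pos_of_lt (Nat.one_lt_pow (by have := V.hd; omega) (Nat.one_lt_two_pow (by omega)))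
  rw [V.γL_eq, ← pow_mul, V.αL_pow_mod, V.αL_pow_mod (rOf a M d * i)]
  congr 1
  rw [zOf, ← hP]
  -- `(r i + (P - (c+1) % P)) % P + c + 1 ≡ r i (mod P)`
  have hc : (cstar + 1) % P ≤ P := (Nat.mod_lt _ hP0).le
  rw [Nat.add_assoc, Nat.add_mod, Nat.mod_mod, ← Nat.add_mod]
  have e : rOf a M d * i + (P - (cstar + 1) % P) + (cstar + 1) = rOf a M d * i + (P + ((cstar + 1) - (cstar + 1) % P)) := by
    have := Nat.mod_le (cstar + 1) P; omega
  rw [e, Nat.add_mod, Nat.add_mod P, Nat.mod_self, zero_add, Nat.mod_mod]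
  have hdiv : ((cstar + 1) - (cstar + 1) % P) % P = 0 := by
    rw [← Nat.dvd_iff_mod_eq_zero]; exact Nat.dvd_sub_mod (cstar + 1)
  rw [hdiv, add_zero, Nat.mod_mod]

/-- **The readout functional**: `dot(coords(x), cl) = N'.coord 1 (x)`. [cite: Umans2003, Def. 9 (P2*)] -/
theorem readout_dot {u : List ℕ} (hu : LRep M d u) :
    GF2.elt M (kdot (kctx M) u V.clOf) = V.NN.coord 1 (ρN (NB V.hlen) u) ∧ kdot (kctx M) u V.clOf < 2 ^ (M + 1) := by
  have hcl : LRep M d V.clOf := ⟨List.length_ofFn, fun x hx => by obtain ⟨jj, rfl⟩ := List.mem_ofFn.1 hx; exact toBits_lt M _⟩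
  obtain ⟨h1, h2⟩ := cast_kdot (M := M) hu.2 hcl.2
  refine ⟨?_, h2⟩
  rw [h1, dot_eq_sum (by rw [length_castVec, hu.1]) (by rw [length_castVec, hcl.1])]
  have hx : ρN (NB V.hlen) u = ∑ jj : Fin d, (GF2.elt M (u.getD jj 0)) • NB V.hlen jj := rfl
  have hgc : ∀ (l : List ℕ) (jj : ℕ), jj < l.length → (castVec M l).getD jj 0 = GF2.elt M (l.getD jj 0) := fun l jj hjj => by
    rw [castVec, List.getD_eq_getElem _ _ (by rw [List.length_map]; exact hjj), List.getElem_map, List.getD_eq_getElem _ _ hjj]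
  have hcj : ∀ jj : Fin d, GF2.elt M (V.clOf.getD jj 0) = V.NN.coord 1 (NB V.hlen jj) := fun jj => by
    rw [clOf, List.getD_eq_getElem _ _ (by rw [List.length_ofFn]; exact jj.2), List.getElem_ofFn, elt_toBits]
  rw [hx, map_sum]
  refine Finset.sum_congr rfl fun jj _ => ?_
  rw [map_smul, smul_eq_mul, hgc u jj (by rw [hu.1]; exact jj.2), hgc _ jj (by rw [hcl.1]; exact jj.2), hcj]

/-- **The readout bit of a list representing `Ẽ(γⁱ)` is the table bit `x_i`.** [cite: Umans2003, Def. 9 (P2*), Thm. 14] -/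
theorem readoutBit_eq (xs : List Bool) (hn : xs.length ≤ (2 ^ a) ^ d - 1) (i : Fin xs.length) {u : List ℕ} (hu : LRep M d u)
    (hval : ρN (NB V.hlen) u = V.EF xs (posF cap a M d xs.length i)) : V.readoutBit u = xs.getD i false := by
  obtain ⟨h1, h2⟩ := V.readout_dot hu
  rw [hval, EF, UmansEnc.coord_one_augE V.NN V.NN_apply, V.φF_pos hn i, tabK] at h1
  rw [readoutBit]
  have hone : GF2.elt M 1 = 1 := by rw [GF2.elt, bitsPoly_one, map_one]
  by_cases hb : xs.getD i false = true
  · rw [hb, if_pos rfl] at h1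
    rw [hb, beq_iff_eq]
    exact GF2.elt_injective h2 (Nat.one_lt_two_pow (by omega)) (h1.trans hone.symm)
  · rw [Bool.not_eq_true] at hb
    rw [hb, if_neg (by simp)] at h1
    rw [hb]
    rw [beq_eq_false_iff_ne]
    intro h
    rw [h, hone] at h1
    exact one_ne_zero h1

/-- **The data tuple of the reconstruction machine** (predictor data, Sudan parameters, node lists,
modulus, `σ`-squarings, `q'`, `P`, `T`). [cite: Umans2003, Thm. 14 (the advice of the reconstruction)] -/
def _root_.Literature.Computability.Complexity.UmansFP.wprmOf (cap a M d : ℕ) {m : ℕ} (C' : Circuit (Fin m)) (j : Fin m) (sgn : Bool) (wc : Fin m → Bool)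
    (D₁ A₁ I₁ J₁ cap₁ D A I J capO : ℕ) {r' : ℕ} (b : UmansRec.Idx d r' ↪ GF2 M) : WPrm :=
  (((CircEval.desc C', List.ofFn wc, sgn), (kctx M, 2 ^ (M + 1), I₁, J₁), (d - 1, A₁, cap₁, D₁)),
    (((kctx M, (2 ^ (M + 1), I, J)), ((D, A, capO), d)), (j : ℕ)),
    bnOf b,
    ((pcOf cap a M d, (M + 1) * (d - 1)), ((2 ^ (M + 1)) ^ (d - 1), (2 ^ (M + 1)) ^ d - 1, ((j : ℕ) + 1) * 2 ^ (M + 1))))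

omit hirr V in
/-- The digit list has `d` reduced digits and reads as the digit function of `z` (for `z < q^d`). [folklore] -/
theorem digitsOf_spec {z : ℕ} (hz : z < (2 ^ (M + 1)) ^ d) :
    (digitsOf M d z).length = d ∧ (∀ w ∈ digitsOf M d z, w < 2 ^ (M + 1)) ∧
      (fun c => (digitsOf M d z).getD c 0) = fun c => z / (2 ^ (M + 1)) ^ c % 2 ^ (M + 1) := by
  refine ⟨by rw [digitsOf, List.length_map, List.length_range], fun w hw => ?_, funext fun c => ?_⟩
  · obtain ⟨c, -, rfl⟩ := List.mem_map.1 hw; exact Nat.mod_lt _ (Nat.two_pow_pos _)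
  · by_cases hc : c < d
    · rw [digitsOf, List.getD_eq_getElem _ _ (by rw [List.length_map, List.length_range]; exact hc), List.getElem_map, List.getElem_range]
    · rw [digitsOf, List.getD_eq_default _ _ (by rw [List.length_map, List.length_range]; omega)]
      rw [Nat.div_eq_of_lt (hz.trans_le (Nat.pow_le_pow_right (Nat.two_pow_pos _) (by omega))), Nat.zero_mod]

open Classical in
/-- **Correctness of the reconstruction machine's core**: with the advice `(wprm, st₀, cl)` built
from good curves `b, v` and the offset `c⋆` of Thm. 14, feeding the digits of `zOf i` reconstructs
`Ẽ(γⁱ)` and the readout bit is `x_i`. [cite: Umans2003, Thm. 14 (proof: "the circuit computing `x`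
from the advice"), §6.3, Def. 9 (P2*)] -/
theorem recon_correct (xs : List Bool) (hn : xs.length ≤ (2 ^ a) ^ d - 1) {m : ℕ} (C' : Circuit (Fin m)) (hC' : C'.IsOver B2)
    (j : Fin m) (hj : 0 < (j : ℕ)) (sgn : Bool) (wc : Fin m → Bool) {D₁ A₁ I₁ J₁ cap₁ ℓ₁ D A I J capO : ℕ}
    (hℓ : 4 ^ (M + 1) ≤ ℓ₁ * D₁ ^ 2) (hD₁ : 1 ≤ D₁) (hIJ₁ : 2 ^ (M + 1) * ℓ₁ < I₁ * J₁) (hA₁ : (I₁ - 1) + (J₁ - 1) * (d - 1) < A₁) (hcap₁ : J₁ ≤ cap₁)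
    (hIJ : 2 ^ (M + 1) * (max 1 cap₁) < I * J) (hA : (I - 1) + (J - 1) * D < A) (hcapO : J ≤ capO)
    {r' : ℕ} (b : UmansRec.Idx d r' ↪ GF2 M) (v : UmansRec.Idx d r' → LF cap a M d) (cstar : ℕ)
    (hrec : ∀ z : ℕ, z < (2 ^ (M + 1)) ^ d →
      (V.XC xs C' j sgn wc D₁ A₁).reconstruct (NB V.hlen) D A hj b (2 ^ (M + 1)) ((2 ^ (M + 1)) ^ (d - 1)) ((2 ^ (M + 1)) ^ d - 1)
          (((j : ℕ) + 1) * 2 ^ (M + 1)) (fun c => z / (2 ^ (M + 1)) ^ c % 2 ^ (M + 1))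
        ((V.XC xs C' j sgn wc D₁ A₁).trueState b 0 0 v) = V.EF xs (αL cap a M d ^ (z + cstar + 1)))
    (i : Fin xs.length) :
    V.readoutBit (reconstructT (wprmOf cap a M d C' j sgn wc D₁ A₁ I₁ J₁ cap₁ D A I J capO b, digitsOf M d (zOf a M d cstar i),
      V.stOf ((V.XC xs C' j sgn wc D₁ A₁).trueState b 0 0 v))) = xs.getD i false := by
  set X := V.XC xs C' j sgn wc D₁ A₁ with hX
  set gd : GDat := ((CircEval.desc C', List.ofFn wc, sgn), (kctx M, 2 ^ (M + 1), I₁, J₁), (d - 1, A₁, cap₁, D₁)) with hgd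
  set z := zOf a M d cstar i with hzdef
  have hP0 : 0 < (2 ^ (M + 1)) ^ d - 1 := Nat.sub_pos_of_lt (Nat.one_lt_pow (by have := V.hd; omega) (Nat.one_lt_two_pow (by omega)))
  have hzP : z < (2 ^ (M + 1)) ^ d - 1 := Nat.mod_lt _ hP0
  have hz : z < (2 ^ (M + 1)) ^ d := hzP.trans_le (Nat.sub_le _ _)
  obtain ⟨hdl, hds, hdf⟩ := digitsOf_spec (M := M) (d := d) hz
  -- the tuple form is the list form
  have hT : reconstructT (wprmOf cap a M d C' j sgn wc D₁ A₁ I₁ J₁ cap₁ D A I J capO b, digitsOf M d z, V.stOf (X.trueState b 0 0 v)) =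
      reconstructL (kctx M) (2 ^ (M + 1)) I J D A capO d X.n₀ (predLT gd) (bnOf b)
        (fun u => lsqIter (kctx M) (pcOf cap a M d) u ((M + 1) * (d - 1))) ((2 ^ (M + 1)) ^ (d - 1)) ((2 ^ (M + 1)) ^ d - 1)
        (((j : ℕ) + 1) * 2 ^ (M + 1)) (digitsOf M d z) (V.stOf (X.trueState b 0 0 v)) := rfl
  -- the walk hypotheses
  have hg : PredOK d (max 1 cap₁) X (ρN (NB V.hlen)) (predLT gd) := fun ws hwl hws =>
    predLT_spec (N := NB V.hlen) C' (arity_le_of_isOver_B2 hC') j (rfl : ((j : ℕ)) = X.n₀) sgn wc V.hd hℓ hD₁ hIJ₁ hA₁ hcap₁ ws hwl hws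
  have H : WalkHyps X (NB V.hlen) D A (ρN (NB V.hlen)) b (max 1 cap₁) I J capO (predLT gd) (bnOf b) :=
    ⟨coordOK_ρN (NB V.hlen), hg, hIJ, hA, hcapO, hj, bnOf_ok b⟩
  obtain ⟨hrep, hval⟩ := reconstructL_ok H (V.sigOK xs C' j sgn wc D₁ A₁) (q' := (2 ^ (M + 1)) ^ (d - 1)) (P := (2 ^ (M + 1)) ^ d - 1)
    (T := ((j : ℕ) + 1) * 2 ^ (M + 1)) (Nat.le_add_left _ _) (V.stOf_ok (X.trueState b 0 0 v)) hds hdl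
  rw [hT]
  refine V.readoutBit_eq xs hn i hrep ?_
  rw [hval, hdf, hrec z hz, hzdef, V.αL_pow_zOf]
  rfl

end Advice

end PrmOK

section Machine

open CodeFP

/-! ### The machine -/

/-- **The advice tuple**: walk data, initial state, readout coefficients, and `(n, r, c⋆, P)`. [cite: Umans2003, Thm. 14] -/
abbrev AdvT : Type := WPrm × WStateL × List ℕ × (ℕ × ℕ × ℕ × ℕ)

/-- The code of the machine state (as in `UmansFPWalkFP.lean`). [folklore] -/
abbrev wstE : WStateL → List Bool := pairE natE (pairE (rawE (rawE (rawE natE))) (rawE (rawE (rawE natE))))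

/-- **The code of the advice.** [folklore] -/
abbrev advE : AdvT → List Bool := pairE wprmE (pairE wstE (pairE (rawE natE) (pairE natE (pairE natE (pairE natE natE)))))

/-- The offset `z` of index `i`: `(r i + (P - (c⋆+1) % P)) % P`. [cite: Umans2003, §6.3] -/
def zL (r cstar P i : ℕ) : ℕ := (r * i + (P - (cstar + 1) % P)) % P

/-- The base-`q` digit list of `z`. [cite: Umans2003, §6.3] -/
def digitsL (d q z : ℕ) : List ℕ := (List.range d).map fun c => z / q ^ c % q

/-- **The reconstruction machine**: on advice `adv` and index bits `ib`, if `i = val(ib) < n`, run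
the walk on the digits of `z(i)` from the advised state and output the readout bit; else `0`.
[cite: Umans2003, Thm. 14 (the reconstruction circuit)] -/
def hOut (adv : AdvT) (ib : List Bool) : List Bool :=
  let i := bitsToNat ib
  if i < adv.2.2.2.1 then
    [kdot adv.1.c (reconstructT (adv.1, digitsL adv.1.d adv.1.q (zL adv.2.2.2.2.1 adv.2.2.2.2.2.1 adv.2.2.2.2.2.2 i), adv.2.1)) adv.2.2.1 == 1]
  else [false]

/-- `zL` on codes. [folklore] -/
theorem zLC : CodeFP (pairE natE (pairE natE (pairE natE natE))) natE (fun t => zL t.1 t.2.1 t.2.2.1 t.2.2.2) := by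
  let E := pairE natE (pairE natE (pairE natE natE))
  have hr : CodeFP E natE (fun t => t.1) := fst _ _
  have hc : CodeFP E natE (fun t => t.2.1) := (snd _ _).fst'
  have hP : CodeFP E natE (fun t => t.2.2.1) := (snd _ _).snd'.fst'
  have hi : CodeFP E natE (fun t => t.2.2.2) := (snd _ _).snd'.snd'
  have h1 : CodeFP E natE (fun t => (t.2.1 + 1) % t.2.2.1) := natMod.comp ((natAdd.comp (hc.pair (const _ 1))).pair hP)
  have h2 : CodeFP E natE (fun t => t.2.2.1 - (t.2.1 + 1) % t.2.2.1) := natSub.comp (hP.pair h1)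
  have h3 : CodeFP E natE (fun t => t.1 * t.2.2.2 + (t.2.2.1 - (t.2.1 + 1) % t.2.2.1)) := natAdd.comp ((natMul.comp (hr.pair hi)).pair h2)
  exact (natMod.comp (h3.pair hP)).congr fun _ => rfl

/-- `digitsL` on codes: `(1ᵈ, q, z) ↦ digitsL d q z`. [folklore] -/
theorem digitsLC : CodeFP (pairE unE (pairE natE natE)) (rawE natE) (fun t => digitsL t.1 t.2.1 t.2.2) := by
  let E := pairE unE (pairE natE natE)
  -- item `c` (numeral from `range d`), exponent in unary capped by `d`
  have hc : CodeFP (pairE E natE) unE (fun u => min u.2 u.1.1) := unOfNatMin.comp ((fst _ _).fst'.pair (snd _ _))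
  have hpow : CodeFP (pairE E natE) natE (fun u => u.1.2.1 ^ min u.2 u.1.1) := natPow.comp ((fst _ _).snd'.fst'.pair hc)
  have hdig : CodeFP (pairE E natE) natE (fun u => u.1.2.2 / u.1.2.1 ^ min u.2 u.1.1 % u.1.2.1) :=
    natMod.comp ((natDiv.comp ((fst _ _).snd'.snd'.pair hpow)).pair (fst _ _).snd'.fst')
  refine ((map hdig).comp ((CodeFP.id _).pair (urange.comp (fst _ _)))).congr fun t => ?_
  obtain ⟨d, q, z⟩ := t
  show (List.range d).map (fun c => z / q ^ min c d % q) = digitsL d q z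
  rw [digitsL]
  refine List.map_congr_left fun c hc => ?_
  rw [min_eq_left (List.mem_range.1 hc).le]

/-- **The machine is polynomial time.** [cite: Umans2003, Thm. 14; AroraBarak2009, §1.3] -/
theorem hOutC : CodeFP (pairE advE strE) strE (fun t => hOut t.1 t.2) := by
  let E := pairE advE strE
  have hw : CodeFP E wprmE (fun t => t.1.1) := (fst _ _).fst'
  have hst : CodeFP E wstE (fun t => t.1.2.1) := (fst _ _).snd'.fst'
  have hcl : CodeFP E (rawE natE) (fun t => t.1.2.2.1) := (fst _ _).snd'.snd'.fst'
  have hn : CodeFP E natE (fun t => t.1.2.2.2.1) := (fst _ _).snd'.snd'.snd'.fst'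
  have hr : CodeFP E natE (fun t => t.1.2.2.2.2.1) := (fst _ _).snd'.snd'.snd'.snd'.fst'
  have hcs : CodeFP E natE (fun t => t.1.2.2.2.2.2.1) := (fst _ _).snd'.snd'.snd'.snd'.snd'.fst'
  have hP : CodeFP E natE (fun t => t.1.2.2.2.2.2.2) := (fst _ _).snd'.snd'.snd'.snd'.snd'.snd'
  have hi : CodeFP E natE (fun t => bitsToNat t.2) := strVal.comp (snd _ _)
  -- accessors of `wprm`: `c = w.2.1.1.1.1`, `q = w.2.1.1.1.2.1`, `d = w.2.1.1.2.2`
  have hcx : CodeFP E kctxE (fun t => t.1.1.c) := hw.snd'.fst'.fst'.fst'.fst'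
  have hq : CodeFP E natE (fun t => t.1.1.q) := natOfUn.comp hw.snd'.fst'.fst'.fst'.snd'.fst'
  have hd : CodeFP E unE (fun t => t.1.1.d) := hw.snd'.fst'.fst'.snd'.snd'
  have hz := zLC.comp (hr.pair (hcs.pair (hP.pair hi)))
  have hdig := digitsLC.comp (hd.pair (hq.pair hz))
  have hrec := reconstructTC.comp (hw.pair (hdig.pair hst))
  have hk := kdotC.comp (hcx.pair (hrec.pair hcl))
  have hbit : CodeFP E bitE (fun t => kdot t.1.1.c (reconstructT (t.1.1, digitsL t.1.1.d t.1.1.q (zL t.1.2.2.2.2.1 t.1.2.2.2.2.2.1 t.1.2.2.2.2.2.2 (bitsToNat t.2)), t.1.2.1)) t.1.2.2.1 == 1) :=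
    ((natEq.comp (hk.pair (const _ 1))).congr fun _ => by rw [Bool.eq_iff_iff, decide_eq_true_eq, beq_iff_eq])
  have hyes : CodeFP E strE (fun t => [kdot t.1.1.c (reconstructT (t.1.1, digitsL t.1.1.d t.1.1.q (zL t.1.2.2.2.2.1 t.1.2.2.2.2.2.1 t.1.2.2.2.2.2.2 (bitsToNat t.2)), t.1.2.1)) t.1.2.2.1 == 1]) :=
    (bitsToStr.comp ((rawSingleton bitE).comp hbit)).congr fun _ => rfl
  have hlt : CodeFP E bitE (fun t => decide (bitsToNat t.2 < t.1.2.2.2.1)) := natLt.comp (hi.pair hn)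
  exact (hlt.ite hyes (const _ [false])).congr fun t => by
    obtain ⟨adv, ib⟩ := t
    show (if decide (bitsToNat ib < adv.2.2.2.1) = true then _ else _) = hOut adv ib
    rw [hOut]
    dsimp only
    by_cases h : bitsToNat ib < adv.2.2.2.1
    · rw [if_pos (decide_eq_true h), if_pos h]
    · rw [if_neg (by rw [decide_eq_false h]; exact Bool.false_ne_true), if_neg h]

/-- **The reconstruction string function `Hf ∈ FP`** with `Hf(⟨advE adv, ib⟩) = hOut adv ib`. [cite: Umans2003, Thm. 14] -/
def Hf : List Bool → List Bool := Classical.choose hOutC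

/-- `Hf ∈ FP`. [cite: AroraBarak2009, §1.3] -/
theorem Hf_mem_FP : Hf ∈ FP := (Classical.choose_spec hOutC).1

/-- `Hf` computes `hOut` on coded inputs. [folklore] -/
theorem Hf_apply (adv : AdvT) (ib : List Bool) : Hf (boolPair (advE adv) ib) = hOut adv ib := (Classical.choose_spec hOutC).2 (adv, ib)

/-! ### From the machine to a small circuit for the table -/

/-- `finTwoEquiv.symm b` has value `b.toNat`. [folklore] -/
theorem val_finTwoEquiv_symm (b : Bool) : ((finTwoEquiv.symm b : Fin 2) : ℕ) = b.toNat := by cases b <;> rfl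

/-- **`bitsToNat` of the bit list of an assignment is its index in the tree's cube enumeration**
(both least-significant-bit first). [cite: KabanetsCai2000, §2] -/
theorem bitsToNat_ofFn : ∀ {ℓ : ℕ} (v : Fin ℓ → Bool), bitsToNat (List.ofFn v) = ((MetaComplexity.boolFunEquivFin ℓ v : Fin (2 ^ ℓ)) : ℕ)
  | 0, v => by simp [MetaComplexity.boolFunEquivFin]
  | ℓ + 1, v => by
    rw [List.ofFn_succ, bitsToNat_cons, bitsToNat_ofFn]
    simp only [MetaComplexity.boolFunEquivFin, Equiv.trans_apply, finFunctionFinEquiv_apply, Equiv.arrowCongr_apply, Equiv.refl_symm,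
      Equiv.coe_refl, Function.comp_apply, id_eq, val_finTwoEquiv_symm]
    rw [Fin.sum_univ_succ]
    simp only [Fin.val_zero, pow_zero, mul_one, Fin.val_succ, pow_succ, Finset.mul_sum]
    congr 1
    refine Finset.sum_congr rfl fun i _ => ?_
    ring

/-- **The fixed size polynomial of the reconstruction machine.** [cite: AroraBarak2009, Thm. 6.6] -/
def QH : Polynomial ℕ := Classical.choose (MetaComplexity.exists_poly_cktSize_apply_getD Hf_mem_FP)

/-- Its defining property. [cite: AroraBarak2009, Thm. 6.6] -/
theorem QH_spec (y : List Bool) (ℓ t : ℕ) :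
    CktSize B2 (fun (s : Fin ℓ → Bool) (_ : Unit) => (Hf (boolPair y (List.ofFn s))).getD t false) (QH.eval (y.length + t + ℓ)) :=
  Classical.choose_spec (MetaComplexity.exists_poly_cktSize_apply_getD Hf_mem_FP) y ℓ t

/-- **If the machine reads the padded table from the advice, the table has a small circuit**:
`CC(Y) ≤ Q_H(|advE adv| + ℓ)`, `ℓ = ⌈log₂(|Y|+1)⌉`. [cite: Umans2003, Thm. 14 ("`x` has circuits of
size `poly(m)`"); MurrayWilliams2018, Thm. 3.1] -/
theorem stringCC_le_of_advice (Y : List Bool) (adv : AdvT)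
    (hadv : ∀ ib : List Bool, ib.length = Nat.clog 2 (Y.length + 1) → hOut adv ib = [(padTable Y).getD (bitsToNat ib) false]) :
    stringCC Y ≤ QH.eval ((advE adv).length + Nat.clog 2 (Y.length + 1)) := by
  set ℓ := Nat.clog 2 (Y.length + 1) with hℓ
  have hck := QH_spec (advE adv) ℓ 0
  rw [add_zero] at hck
  obtain ⟨C, hB, hsize, hev⟩ := CktSize.toCircuit hck
  have hcomp : C.Computes (MetaComplexity.ofTruthTable (padTable Y) (length_padTable Y)) := by
    intro s
    rw [hev s, Hf_apply, hadv (List.ofFn s) (by rw [List.length_ofFn]), List.getD_cons_zero, MetaComplexity.ofTruthTable,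
      List.get_eq_getElem, ← List.getD_eq_getElem _ false, bitsToNat_ofFn]
    rfl
  rw [stringCC]
  exact (circuitSizeOver_le_of_computes C hB hcomp).trans hsize

end Machine

end UmansFP

end Literature.Computability.Complexity

end
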